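import Summits.Ventures.LatticeQCDFlow.Scaling.BooleanStarLipschitzPotential

/-!
HONEST FRAMING: exact (Metropolis-corrected) sampling algorithms for lattice gauge theory; figures
of merit are autocorrelation/cost numbers at stated couplings and volumes; no continuum-physics
claim.

# BooleanStarOneCopyDrift — THE THREE-STATE CLASS VALUES ARE ONE-COPY QUANTITIES: THE CLASS DETERMINANT FACTORS AS `h(h+λ_X)(h+λ_Y)`, THE WEIGHTS ARE
# ONE-COPY SWAP PROBABILITIES, AND OPEN-MATH ITEM 1 (ii) FOR THE HOMOGENEOUS BOOLEAN STAR (ALL `K`) REDUCES TO A ONE-DIMENSIONAL DRIFT INEQUALITY (lean-2 GEN-32, ours)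

Venture-side (OURS).  Cell `lqcd-flow` (pub-lqcd), unit `pub-lqcd-lean-2-g32`, 2026-08-29.  Chapter S, file 9, on top of `BooleanStarLipschitzPotential` (S7).
S7 reduced item 1 (ii) for the homogeneous Boolean star to the redraw contraction `μ_0(b)U(D,N) + μ_0(b̄)V(D,N) ≤ (1−ρ)Ψa(D,N)` for `Ψa = 𝟙{D≥1}(D + φ(N) + φ(N+D))`,
`U, V` the Cramer values of the aligned three-state class system (S6).  THIS FILE observes that the three-state chain of a class `(G, N, D)` is the joint law of the two
copies' hub contents, EACH OF WHICH IS A TWO-STATE CHAIN (a copy with cold `b̄`-count `B` and hub content `b` passes its hub content into the cold levels at rate `cB` and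
gets it back at rate `c·rr·(K−B+1)`; with hub content `b̄` the rates are `c(K−B)rr` and `c(B+1)`), killed at the redraw rate `h = (1−t)w_0`.  Consequently (pure algebra,
hypothesis-equations, checked by `ring`): the class determinant is `det = h·(h + λ_X)·(h + λ_Y)` with `λ_X = cN + c·rr(G+D+1)`, `λ_Y = c(N+D) + c·rr(G+1)` the two
copies' two-state total rates, and the row weights of the values are ONE-COPY SWAP PROBABILITIES: from the `bb` hub, `P(v at the redraw) = π_b(N)`, `P(v or w) = π_b(N+D)`
with `π_b(B) = cB/(h + cB + c·rr(K−B+1))`; from the `b̄b̄` hub (class `(G−1, N+1, D)`), `P(u') = π_b̄(N+D)`, `P(u' or w') = π_b̄(N)` with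
`π_b̄(B) = c(K−B)rr/(h + c(K−B)rr + c(B+1))` (`B_X = N` and `B_Y = N + D` are the two copies' cold `b̄`-counts; `c = t/K`).

Reading `Ψa = 𝟙{D≥1}(D + φ(B_X) + φ(B_Y))` along the two copies, the values become `U ≤ Ψa − [π_b(B_Y) − π_b(B_X)] − π_b(B_X)∇⁻φ(B_X) − π_b(B_Y)∇⁻φ(B_Y)` and
`V ≤ Ψa − [π_b̄(B_X) − π_b̄(B_Y)] + π_b̄(B_X)∇⁺φ(B_X) + π_b̄(B_Y)∇⁺φ(B_Y)` (equalities unless `D = 1`, where the coalesced datum is `0`), so the redraw contraction — hence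
the law — follows from the ONE-DIMENSIONAL DRIFT INEQUALITY, for all naturals `B₁ < B₂ ≤ K`:

  `ρ·(B₂ − B₁ + φ(B₁) + φ(B₂)) ≤ μ_0(b)[π_b(B₂) − π_b(B₁)] + μ_0(b̄)[π_b̄(B₁) − π_b̄(B₂)] + d(B₁) + d(B₂)`,
  `d(B) = μ_0(b)π_b(B)(φ(B) − φ(B−1)) − μ_0(b̄)π_b̄(B)(φ(B+1) − φ(B))` = minus the one-cycle drift of `φ` along ONE copy's cold `b̄`-count.

The coupling enters only through the first bracket (monotone differences of one-copy swap probabilities: `π_b` increases, `π_b̄` decreases in `B`); the environment part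
of the potential only through each copy's own drift.  With `φ ≡ 0` the bracket alone gives S8's law (`π_b(B₂) − π_b(B₁) ≥ (B₂−B₁)·c(h + rr(t+c))/(h+t+c)²`); the corner
S8 leaves (`rr ≪ μ_0(b)`, `t ≫ h`, where `π_b` saturates) is where `d(B)` must pay, i.e. where `φ` is needed — now a statement about a birth–death chain on `{0,…,K}`.

## What is proved

* **`boolStar_oneCopyDrift_contr`** — for `Ψa = 𝟙{D≥1}(D + φ(N) + φ(N+D))`, `φ ≥ 0`, the exact values `U, V` of S6/S7 and every configuration: the one-dimensional drift
  inequality (all naturals `B₁ < B₂ ≤ K`) implies `μ_0(b)U + μ_0(b̄)V ≤ (1−ρ)Ψa` (inside: the factorisation `det = h(h+λ_X)(h+λ_Y)` and the four weight identities).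
* **`boolStar_mixingTime_le_of_oneCopyDrift`** — the homogeneous Boolean star (`m ≥ 1` uniform entries, `0 < t < 1`, `w_0 > 0`, positive laws, idle cold levels), `φ ≥ 0`
  `1`-Lipschitz with `φ(n) ≤ Φm` on `n ≤ K`, `0 < ρ ≤ 1` and the drift inequality ⇒ `t_mix(ε) ≤ ⌈(4/(hρ))·log((e(K+2Φm)+1)/ε)⌉₊`.

NOT CLAIMED: the drift inequality for any particular `φ` beyond `φ ≡ 0` (S8); anything measured.  Literature grade (cell rule): OWN, elementary; nothing cited as a fact;
no new bib keys.
-/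

noncomputable section

namespace Summit.Ventures.LatticeQCDFlow.Scaling

/-! ## §1 The redraw contraction from the one-copy drift inequality -/

section Law
open Finset Function Matrix
open Literature.Probability.MarkovChains

variable {K m : ℕ} {μ : Fin (K + 1) → Bool → ℝ} {M : Fin (K + 1) → Bool → Bool → ℝ} {w : Fin (K + 1) → ℝ} {t : ℝ}
variable (κ : Fin m → Fin K) {cnt : (Fin (K + 1) → Bool) × (Fin (K + 1) → Bool) → Bool → Bool → ℝ}

omit κ in
/-- **THE THREE-STATE VALUES ARE ONE-COPY QUANTITIES.**  For `Ψa = 𝟙{D≥1}(D + φ(B_X) + φ(B_Y))` (`B_X = N`, `B_Y = N + D` the two copies' cold `b̄`-counts) the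
exact class values satisfy, at every configuration with `D ≥ 1`,
`U ≤ Ψa − [π_b(B_Y) − π_b(B_X)] − π_b(B_X)·∇⁻φ(B_X) − π_b(B_Y)·∇⁻φ(B_Y)` and `V ≤ Ψa − [π_b̄(B_X) − π_b̄(B_Y)] + π_b̄(B_X)·∇⁺φ(B_X) + π_b̄(B_Y)·∇⁺φ(B_Y)`,
where `π_b(B) = cB/(h + cB + c·rr·(K−B+1))`, `π_b̄(B) = c(K−B)rr/(h + c(K−B)rr + c(B+1))` are the probabilities that ONE copy with cold `b̄`-count `B` and a fresh hub
content `b` (resp. `b̄`) holds the swapped hub content at the next redraw (the class determinant factors as `h(h+λ_X)(h+λ_Y)` over the two copies' two-state rates);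
hence the ONE-COPY DRIFT INEQUALITY `ρ(B₂ − B₁ + φ(B₁) + φ(B₂)) ≤ μ_0(b)[π_b(B₂) − π_b(B₁)] + μ_0(b̄)[π_b̄(B₁) − π_b̄(B₂)] + d(B₁) + d(B₂)`
(`d(B) = μ_0(b)π_b(B)∇⁻φ(B) − μ_0(b̄)π_b̄(B)∇⁺φ(B)` = minus the one-cycle drift of `φ` along one copy's count) for all naturals `B₁ < B₂ ≤ K` implies the redraw
contraction `μ_0(b)U + μ_0(b̄)V ≤ (1−ρ)Ψa` at every configuration. [ours] -/
theorem boolStar_oneCopyDrift_contr (ht0 : 0 < t) (ht1 : t < 1) (hw00 : 0 < w 0) (hμ : ∀ k x, 0 < μ k x) (hμ1 : ∀ k, ∑ u, μ k u = 1)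
    (hK1 : (1 : ℝ) ≤ K) {b : Bool} (hb : μ 0 b * μ 1 (!b) ≤ μ 0 (!b) * μ 1 b) {rr : ℝ} (hrr : rr = μ 0 b * μ 1 (!b) / (μ 0 (!b) * μ 1 b))
    (hcnt : ∀ a s t, cnt a s t = ((univ.filter fun i : Fin K => a.1 i.succ = s ∧ a.2 i.succ = t).card : ℝ))
    {Dc Nc : (Bool → Bool → ℝ) → ℝ} (hD : ∀ c, Dc c = c b (!b) + c (!b) b) (hN : ∀ c, Nc c = c (!b) (!b))
    {φ : ℝ → ℝ} (hφ0 : ∀ x, 0 ≤ φ x)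
    {Ψa : ℝ → ℝ → ℝ} (hΨ : ∀ D N, Ψa D N = if 1 ≤ D then D + φ N + φ (N + D) else 0)
    {p1 p2 p3 det detu detv : ℝ → ℝ → ℝ → ℝ}
    (hp1 : ∀ G N D, p1 G N D = t + (1 - t) * w 0 - t / K * G)
    (hp2 : ∀ G N D, p2 G N D = t + (1 - t) * w 0 - t / K * ((G + 1) * (1 - rr) + (N - 1) + D * (1 - rr)))
    (hp3 : ∀ G N D, p3 G N D = t + (1 - t) * w 0 - t / K * ((G + 1) * (1 - rr) + (D - 1)))
    (hdet : ∀ G N D, det G N D = p1 G N D * (p2 G N D * p3 G N D - (t / K * D * rr) * (t / K * N))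
      - (t / K) ^ 2 * N * (G + 1) * rr * (p3 G N D + t / K * D * rr) - (t / K) ^ 2 * D * (G + 1) * rr * (t / K * N + p2 G N D))
    (hdetu : ∀ G N D, detu G N D = (1 - t) * w 0 * Ψa D N * (p2 G N D * p3 G N D - (t / K * D * rr) * (t / K * N))
      + (1 - t) * w 0 * Ψa D (N - 1) * (t / K * N * (p3 G N D + t / K * D)) + (1 - t) * w 0 * Ψa (D - 1) N * (t / K * D * (t / K * N * rr + p2 G N D)))
    (hdetv : ∀ G N D, detv G N D = (1 - t) * w 0 * Ψa D (N - 1) * (p1 G N D * p3 G N D - (t / K) ^ 2 * D * (G + 1) * rr)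
      + (1 - t) * w 0 * Ψa D N * (t / K * (G + 1) * rr * (p3 G N D + t / K * D * rr))
      + (1 - t) * w 0 * Ψa (D - 1) N * (t / K * D * rr * (p1 G N D + t / K * (G + 1))))
    {U V : ℝ → ℝ → ℝ}
    (hU : ∀ D N, U D N = detu (K - D - N) N D / det (K - D - N) N D)
    (hV : ∀ D N, V D N = detv (K - D - N - 1) (N + 1) D / det (K - D - N - 1) (N + 1) D)
    {πb πb' : ℝ → ℝ} (hπb : ∀ B, πb B = t / K * B / ((1 - t) * w 0 + t / K * B + t / K * rr * (K - B + 1)))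
    (hπb' : ∀ B, πb' B = t / K * (K - B) * rr / ((1 - t) * w 0 + t / K * (K - B) * rr + t / K * (B + 1)))
    {ρ : ℝ}
    (h1D : ∀ B₁ B₂ : ℕ, B₁ + 1 ≤ B₂ → B₂ ≤ K →
      ρ * ((B₂ : ℝ) - B₁ + φ B₁ + φ B₂) ≤ μ 0 b * (πb B₂ - πb B₁) + μ 0 (!b) * (πb' B₁ - πb' B₂)
        + (μ 0 b * πb B₁ * (φ B₁ - φ (B₁ - 1)) - μ 0 (!b) * πb' B₁ * (φ (B₁ + 1) - φ B₁))
        + (μ 0 b * πb B₂ * (φ B₂ - φ (B₂ - 1)) - μ 0 (!b) * πb' B₂ * (φ (B₂ + 1) - φ B₂)))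
    (a : (Fin (K + 1) → Bool) × (Fin (K + 1) → Bool)) :
    μ 0 b * U (Dc (cnt a)) (Nc (cnt a)) + μ 0 (!b) * V (Dc (cnt a)) (Nc (cnt a)) ≤ (1 - ρ) * Ψa (Dc (cnt a)) (Nc (cnt a)) := by
  have hh : 0 < (1 - t) * w 0 := mul_pos (by linarith) hw00
  have hK0 : (K : ℝ) ≠ 0 := by positivity
  obtain ⟨-, hrr0, -⟩ := boolStar_acc_disliked (acc := fun u v => min 1 (μ 0 v * μ 1 u / (μ 0 u * μ 1 v))) hμ (fun u v => rfl) hb hrr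
  have hc0 : ∀ s t', 0 ≤ cnt a s t' := fun s t' => by rw [hcnt]; exact Nat.cast_nonneg _
  have htot := boolStar_cnt_total hcnt b a
  have hμb : μ 0 b + μ 0 (!b) = 1 := by have := hμ1 0; rw [Fintype.sum_bool] at this; cases b <;> simp at this ⊢ <;> linarith
  have hμ0 : 0 ≤ μ 0 b := (hμ 0 b).le
  have hμ0' : 0 ≤ μ 0 (!b) := (hμ 0 (!b)).le
  -- the naturals behind `N` and `D`
  obtain ⟨nD, hnD⟩ := (boolStar_Dc_natCast hcnt hD a).1
  have hnN : Nc (cnt a) = ((univ.filter fun i : Fin K => a.1 i.succ = !b ∧ a.2 i.succ = !b).card : ℝ) := by rw [hN, hcnt]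
  set nN := (univ.filter fun i : Fin K => a.1 i.succ = !b ∧ a.2 i.succ = !b).card with hnNdef
  set D := Dc (cnt a) with hDdef
  set N := Nc (cnt a) with hNdef
  have hN0 : 0 ≤ N := by rw [hnN]; exact Nat.cast_nonneg _
  have hG0 : 0 ≤ (K : ℝ) - D - N := by
    have e : (K : ℝ) - D - N = cnt a b b := by rw [hDdef, hNdef, hD, hN]; linarith
    rw [e]; exact hc0 b b
  rcases Nat.eq_zero_or_pos nD with h0 | hpos
  · -- `D = 0`: the potential and both values vanish
    have hD0 : D = 0 := by rw [hnD, h0]; simp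
    have z : ∀ N', Ψa D N' = 0 ∧ Ψa (D - 1) N' = 0 := fun N' => by
      rw [hΨ, hΨ, if_neg (by rw [hD0]; norm_num), if_neg (by rw [hD0]; norm_num)]; exact ⟨rfl, rfl⟩
    rw [hU, hV, hdetu, hdetv, (z N).1, (z N).2, (z (N - 1)).1, (z (N + 1 - 1)).1, (z (N + 1)).1, (z (N + 1)).2]
    simp
  -- `D ≥ 1`
  have hD1 : 1 ≤ D := by rw [hnD]; exact_mod_cast hpos
  have hK : (nN : ℝ) + nD ≤ K := by rw [← hnN, ← hnD]; linarith
  have key := h1D nN (nN + nD) (by omega) (by exact_mod_cast hK)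
  push_cast at key
  rw [← hnN, ← hnD, show N + D - N = D by ring] at key
  -- abbreviations `c = t/K`, `hh' = (1−t)w_0`
  set c := t / K with hc
  set hh' := (1 - t) * w 0 with hhh
  have hcK : t = c * K := by rw [hc]; field_simp
  have hc0' : 0 < c := div_pos ht0 (by positivity)
  have X0 : Ψa D N = D + φ N + φ (N + D) := by rw [hΨ, if_pos hD1]
  -- the `w`-state datum is at most `D − 1 + φ(·) + φ(· + D − 1)` (equality unless `D = 1`, where it is `0`)
  have hψw : ∀ N', Ψa (D - 1) N' ≤ D - 1 + φ N' + φ (N' + D - 1) := fun N' => by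
    rw [hΨ]; split_ifs with h1
    · rw [show N' + (D - 1) = N' + D - 1 by ring]
    · linarith [hφ0 N', hφ0 (N' + D - 1)]
  ------------------------------------------------------------------
  -- the class of `U(D,N)`: `(K − D − N, N, D)`; two-state factors `LX = h + λ_X`, `LY = h + λ_Y`
  ------------------------------------------------------------------
  have hLX0 : 0 < hh' + c * N + c * rr * (K - N + 1) := by
    have : 0 ≤ c * rr * (K - N + 1) := mul_nonneg (mul_nonneg hc0'.le hrr0) (by linarith)
    have : 0 ≤ c * N := by positivity
    linarith
  have hLY0 : 0 < hh' + c * (N + D) + c * rr * (K - (N + D) + 1) := by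
    have : 0 ≤ c * rr * (K - (N + D) + 1) := mul_nonneg (mul_nonneg hc0'.le hrr0) (by linarith)
    have : 0 ≤ c * (N + D) := by positivity
    linarith
  have qX : πb N * (hh' + c * N + c * rr * (K - N + 1)) = c * N := by rw [hπb]; exact div_mul_cancel₀ _ hLX0.ne'
  have qY : πb (N + D) * (hh' + c * (N + D) + c * rr * (K - (N + D) + 1)) = c * (N + D) := by
    rw [hπb]; exact div_mul_cancel₀ _ hLY0.ne'
  set LX := hh' + c * N + c * rr * (K - N + 1) with hLX
  set LY := hh' + c * (N + D) + c * rr * (K - (N + D) + 1) with hLY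
  have edet : det (K - D - N) N D = hh' * LX * LY := by rw [hdet, hp1, hp2, hp3, hcK, hLX, hLY]; ring
  have hdetpos : 0 < det (K - D - N) N D := by rw [edet]; positivity
  have r1 := (threeState_rowsum (G := K - D - N) (N := N) (D := D) (c := c) (h := hh') (rr := rr) (by rw [hcK]; ring)
    (hp1 _ _ _) (hp2 _ _ _) (hp3 _ _ _) (hdet _ _ _)).1
  have eC12 : hh' * (c * N * (p3 (K - D - N) N D + c * D)) = c * N * (hh' * LY) := by rw [hp3, hcK, hLY]; ring
  have eC13 : hh' * (c * D * (c * N * rr + p2 (K - D - N) N D)) = c * (N + D) * (hh' * LX) - c * N * (hh' * LY) := by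
    rw [hp2, hcK, hLX, hLY]; ring
  have hC13 : 0 ≤ c * (N + D) * (hh' * LX) - c * N * (hh' * LY) := by
    have e : c * (N + D) * (hh' * LX) - c * N * (hh' * LY) = hh' * (c * D * (hh' + rr * (c * (K + 1)))) := by rw [hLX, hLY]; ring
    rw [e]; positivity
  have e11 : hh' * (p2 (K - D - N) N D * p3 (K - D - N) N D - (c * D * rr) * (c * N)) = det (K - D - N) N D - c * (N + D) * (hh' * LX) := by
    linear_combination r1 - eC12 - eC13
  have w1 : πb N * det (K - D - N) N D = c * N * (hh' * LY) := by
    rw [edet, show πb N * (hh' * LX * LY) = (πb N * LX) * (hh' * LY) by ring, qX]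
  have w2 : πb (N + D) * det (K - D - N) N D = c * (N + D) * (hh' * LX) := by
    rw [edet, show πb (N + D) * (hh' * LX * LY) = (πb (N + D) * LY) * (hh' * LX) by ring, qY]
  have Xv : Ψa D (N - 1) = D + φ (N - 1) + φ (N + D - 1) := by rw [hΨ, if_pos hD1, show N - 1 + D = N + D - 1 by ring]
  have m3 := mul_le_mul_of_nonneg_right (hψw N) hC13
  have mainU : hh' * Ψa D N * (p2 (K - D - N) N D * p3 (K - D - N) N D - (c * D * rr) * (c * N))
      + hh' * Ψa D (N - 1) * (c * N * (p3 (K - D - N) N D + c * D)) + hh' * Ψa (D - 1) N * (c * D * (c * N * rr + p2 (K - D - N) N D))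
      ≤ (Ψa D N - (πb (N + D) - πb N) - πb N * (φ N - φ (N - 1)) - πb (N + D) * (φ (N + D) - φ (N + D - 1))) * det (K - D - N) N D := by
    have eR : (Ψa D N - (πb (N + D) - πb N) - πb N * (φ N - φ (N - 1)) - πb (N + D) * (φ (N + D) - φ (N + D - 1)))
        * det (K - D - N) N D = Ψa D N * det (K - D - N) N D - (c * (N + D) * (hh' * LX)) * (1 + (φ (N + D) - φ (N + D - 1)))
          + (c * N * (hh' * LY)) * (1 + (φ (N + D) - φ (N + D - 1))) - (c * N * (hh' * LY)) * ((φ N - φ (N - 1)) + (φ (N + D) - φ (N + D - 1))) := by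
      rw [← w1, ← w2]; ring
    have eL : hh' * Ψa D N * (p2 (K - D - N) N D * p3 (K - D - N) N D - (c * D * rr) * (c * N))
        + hh' * Ψa D (N - 1) * (c * N * (p3 (K - D - N) N D + c * D)) + hh' * Ψa (D - 1) N * (c * D * (c * N * rr + p2 (K - D - N) N D))
        = Ψa D N * (det (K - D - N) N D - c * (N + D) * (hh' * LX)) + Ψa D (N - 1) * (c * N * (hh' * LY))
          + Ψa (D - 1) N * (c * (N + D) * (hh' * LX) - c * N * (hh' * LY)) := by
      linear_combination (Ψa D N) * e11 + (Ψa D (N - 1)) * eC12 + (Ψa (D - 1) N) * eC13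
    rw [eR, eL, X0, Xv]
    linarith [m3]
  have hUle : U D N ≤ Ψa D N - (πb (N + D) - πb N) - πb N * (φ N - φ (N - 1)) - πb (N + D) * (φ (N + D) - φ (N + D - 1)) := by
    rw [hU, div_le_iff₀ hdetpos, hdetu]; linarith [mainU]
  ------------------------------------------------------------------
  -- the class of `V(D,N)`: `(K − D − N − 1, N + 1, D)`; factors `LX' = h + λ'_X`, `LY' = h + λ'_Y`
  ------------------------------------------------------------------
  have hLX'0 : 0 < hh' + c * (K - N) * rr + c * (N + 1) := by
    have : 0 ≤ c * (K - N) * rr := mul_nonneg (mul_nonneg hc0'.le (by linarith)) hrr0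
    have : 0 ≤ c * (N + 1) := by positivity
    linarith
  have hLY'0 : 0 < hh' + c * (K - (N + D)) * rr + c * (N + D + 1) := by
    have : 0 ≤ c * (K - (N + D)) * rr := mul_nonneg (mul_nonneg hc0'.le (by linarith)) hrr0
    have : 0 ≤ c * (N + D + 1) := by positivity
    linarith
  have qX' : πb' N * (hh' + c * (K - N) * rr + c * (N + 1)) = c * (K - N) * rr := by rw [hπb']; exact div_mul_cancel₀ _ hLX'0.ne'
  have qY' : πb' (N + D) * (hh' + c * (K - (N + D)) * rr + c * (N + D + 1)) = c * (K - (N + D)) * rr := by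
    rw [hπb']; exact div_mul_cancel₀ _ hLY'0.ne'
  set LX' := hh' + c * (K - N) * rr + c * (N + 1) with hLX'
  set LY' := hh' + c * (K - (N + D)) * rr + c * (N + D + 1) with hLY'
  have edet' : det (K - D - N - 1) (N + 1) D = hh' * LX' * LY' := by rw [hdet, hp1, hp2, hp3, hcK, hLX', hLY']; ring
  have hdetpos' : 0 < det (K - D - N - 1) (N + 1) D := by rw [edet']; positivity
  have r2 := (threeState_rowsum (G := K - D - N - 1) (N := N + 1) (D := D) (c := c) (h := hh') (rr := rr) (by rw [hcK]; ring)
    (hp1 _ _ _) (hp2 _ _ _) (hp3 _ _ _) (hdet _ _ _)).2.1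
  have eC21 : hh' * (c * (K - D - N - 1 + 1) * rr * (p3 (K - D - N - 1) (N + 1) D + c * D * rr)) = c * (K - (N + D)) * rr * (hh' * LX') := by
    rw [hp3, hcK, hLX']; ring
  have eC23 : hh' * (c * D * rr * (p1 (K - D - N - 1) (N + 1) D + c * (K - D - N - 1 + 1)))
      = c * (K - N) * rr * (hh' * LY') - c * (K - (N + D)) * rr * (hh' * LX') := by rw [hp1, hcK, hLX', hLY']; ring
  have hC23 : 0 ≤ c * (K - N) * rr * (hh' * LY') - c * (K - (N + D)) * rr * (hh' * LX') := by
    have e : c * (K - N) * rr * (hh' * LY') - c * (K - (N + D)) * rr * (hh' * LX') = hh' * (c * D * rr * (hh' + c * (K + 1))) := by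
      rw [hLX', hLY']; ring
    rw [e]; positivity
  have e22 : hh' * (p1 (K - D - N - 1) (N + 1) D * p3 (K - D - N - 1) (N + 1) D - c ^ 2 * D * (K - D - N - 1 + 1) * rr)
      = det (K - D - N - 1) (N + 1) D - c * (K - N) * rr * (hh' * LY') := by
    linear_combination r2 - eC21 - eC23
  have w1' : πb' N * det (K - D - N - 1) (N + 1) D = c * (K - N) * rr * (hh' * LY') := by
    rw [edet', show πb' N * (hh' * LX' * LY') = (πb' N * LX') * (hh' * LY') by ring, qX']
  have w2' : πb' (N + D) * det (K - D - N - 1) (N + 1) D = c * (K - (N + D)) * rr * (hh' * LX') := by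
    rw [edet', show πb' (N + D) * (hh' * LX' * LY') = (πb' (N + D) * LY') * (hh' * LX') by ring, qY']
  have Xu : Ψa D (N + 1) = D + φ (N + 1) + φ (N + D + 1) := by rw [hΨ, if_pos hD1, show N + 1 + D = N + D + 1 by ring]
  have m3' := mul_le_mul_of_nonneg_right (hψw (N + 1)) hC23
  rw [show N + 1 + D - 1 = N + D by ring] at m3'
  have mainV : hh' * Ψa D N * (p1 (K - D - N - 1) (N + 1) D * p3 (K - D - N - 1) (N + 1) D - c ^ 2 * D * (K - D - N - 1 + 1) * rr)
      + hh' * Ψa D (N + 1) * (c * (K - D - N - 1 + 1) * rr * (p3 (K - D - N - 1) (N + 1) D + c * D * rr))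
      + hh' * Ψa (D - 1) (N + 1) * (c * D * rr * (p1 (K - D - N - 1) (N + 1) D + c * (K - D - N - 1 + 1)))
      ≤ (Ψa D N - (πb' N - πb' (N + D)) + πb' N * (φ (N + 1) - φ N) + πb' (N + D) * (φ (N + D + 1) - φ (N + D)))
        * det (K - D - N - 1) (N + 1) D := by
    have eR : (Ψa D N - (πb' N - πb' (N + D)) + πb' N * (φ (N + 1) - φ N) + πb' (N + D) * (φ (N + D + 1) - φ (N + D)))
        * det (K - D - N - 1) (N + 1) D = Ψa D N * det (K - D - N - 1) (N + 1) D
          - (c * (K - N) * rr * (hh' * LY')) * (1 - (φ (N + 1) - φ N))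
          + (c * (K - (N + D)) * rr * (hh' * LX')) * (1 - (φ (N + 1) - φ N))
          + (c * (K - (N + D)) * rr * (hh' * LX')) * ((φ (N + 1) - φ N) + (φ (N + D + 1) - φ (N + D))) := by
      rw [← w1', ← w2']; ring
    have eL : hh' * Ψa D N * (p1 (K - D - N - 1) (N + 1) D * p3 (K - D - N - 1) (N + 1) D - c ^ 2 * D * (K - D - N - 1 + 1) * rr)
        + hh' * Ψa D (N + 1) * (c * (K - D - N - 1 + 1) * rr * (p3 (K - D - N - 1) (N + 1) D + c * D * rr))
        + hh' * Ψa (D - 1) (N + 1) * (c * D * rr * (p1 (K - D - N - 1) (N + 1) D + c * (K - D - N - 1 + 1)))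
        = Ψa D N * (det (K - D - N - 1) (N + 1) D - c * (K - N) * rr * (hh' * LY')) + Ψa D (N + 1) * (c * (K - (N + D)) * rr * (hh' * LX'))
          + Ψa (D - 1) (N + 1) * (c * (K - N) * rr * (hh' * LY') - c * (K - (N + D)) * rr * (hh' * LX')) := by
      linear_combination (Ψa D N) * e22 + (Ψa D (N + 1)) * eC21 + (Ψa (D - 1) (N + 1)) * eC23
    rw [eR, eL, X0, Xu]
    linarith [m3']
  have hVle : V D N ≤ Ψa D N - (πb' N - πb' (N + D)) + πb' N * (φ (N + 1) - φ N) + πb' (N + D) * (φ (N + D + 1) - φ (N + D)) := by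
    rw [hV, div_le_iff₀ hdetpos', hdetv, show N + 1 - 1 = N by ring]; linarith [mainV]
  -- combine with the one-copy drift inequality at `(B₁, B₂) = (N, N + D)`
  have k1 := mul_le_mul_of_nonneg_left hUle hμ0
  have k2 := mul_le_mul_of_nonneg_left hVle hμ0'
  rw [← X0] at key
  have e1 : (1 - ρ) * Ψa D N = (μ 0 b + μ 0 (!b)) * Ψa D N - ρ * Ψa D N := by rw [hμb]; ring
  rw [e1]
  linarith [k1, k2, key]

/-- **THE COLD-START LAW OF THE HOMOGENEOUS BOOLEAN STAR, ALL `K`, FROM A ONE-DIMENSIONAL DRIFT INEQUALITY.**  Setting of S7/S8 (persistent hub, `K` idle cold levels with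
contents `Bool`, homogeneous cold law, uniform entry list with `m ≥ 1`, exact hot redraws at weight `w_0 > 0`, swap rate `0 < t < 1`, liked content `b`, `rr` the
disliked acceptance, `h = (1−t)w_0`, `c = t/K`).  Let `φ ≥ 0` be `1`-Lipschitz with `φ(n) ≤ Φm` for naturals `n ≤ K`, and let
`π_b(B) = cB/(h + cB + c·rr·(K−B+1))`, `π_b̄(B) = c(K−B)rr/(h + c(K−B)rr + c(B+1))` (one copy's probability of holding the swapped hub content at the next redraw, from cold
`b̄`-count `B` and fresh hub content `b`, resp. `b̄`).  IF for all naturals `B₁ < B₂ ≤ K`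
`ρ·(B₂ − B₁ + φ(B₁) + φ(B₂)) ≤ μ_0(b)[π_b(B₂) − π_b(B₁)] + μ_0(b̄)[π_b̄(B₁) − π_b̄(B₂)] + Σ_{i=1,2} (μ_0(b)π_b(B_i)(φ(B_i) − φ(B_i−1)) − μ_0(b̄)π_b̄(B_i)(φ(B_i+1) − φ(B_i)))`
with `0 < ρ ≤ 1`, THEN **`t_mix(ε) ≤ ⌈(4/(hρ))·log((e(K + 2Φm) + 1)/ε)⌉₊`**.  (The coupling enters only through the first bracket — a difference of ONE-copy swap
probabilities —, the potential's environment part only through each copy's own one-cycle drift of `φ`.) [ours] -/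
theorem boolStar_mixingTime_le_of_oneCopyDrift (hm : 1 ≤ m) (ht0 : 0 < t) (ht1 : t < 1) (hw0 : ∀ k, 0 ≤ w k) (hw00 : 0 < w 0)
    (hw1 : ∑ k, w k = 1) (hμ : ∀ k x, 0 < μ k x) (hμ1 : ∀ k, ∑ u, μ k u = 1) (hM0 : ∀ u v, M 0 u v = μ 0 v)
    (hidle : ∀ i : Fin K, ∀ u v, M i.succ u v = if v = u then 1 else 0) (hhom : ∀ i : Fin K, μ i.succ = μ 1)
    {c0 : ℕ} (hunif : ∀ i : Fin K, (univ.filter fun r : Fin m => κ r = i).card = c0)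
    {b : Bool} (hb : μ 0 b * μ 1 (!b) ≤ μ 0 (!b) * μ 1 b) {rr : ℝ} (hrr : rr = μ 0 b * μ 1 (!b) / (μ 0 (!b) * μ 1 b))
    {φ : ℝ → ℝ} (hφ0 : ∀ x, 0 ≤ φ x) (hφ : ∀ x y, |φ x - φ y| ≤ |x - y|) {Φm : ℝ} (hφm : ∀ n : ℕ, n ≤ K → φ n ≤ Φm)
    {πb πb' : ℝ → ℝ} (hπb : ∀ B, πb B = t / K * B / ((1 - t) * w 0 + t / K * B + t / K * rr * (K - B + 1)))
    (hπb' : ∀ B, πb' B = t / K * (K - B) * rr / ((1 - t) * w 0 + t / K * (K - B) * rr + t / K * (B + 1)))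
    {ρ : ℝ} (hρ0 : 0 < ρ) (hρ1 : ρ ≤ 1)
    (h1D : ∀ B₁ B₂ : ℕ, B₁ + 1 ≤ B₂ → B₂ ≤ K →
      ρ * ((B₂ : ℝ) - B₁ + φ B₁ + φ B₂) ≤ μ 0 b * (πb B₂ - πb B₁) + μ 0 (!b) * (πb' B₁ - πb' B₂)
        + (μ 0 b * πb B₁ * (φ B₁ - φ (B₁ - 1)) - μ 0 (!b) * πb' B₁ * (φ (B₁ + 1) - φ B₁))
        + (μ 0 b * πb B₂ * (φ B₂ - φ (B₂ - 1)) - μ 0 (!b) * πb' B₂ * (φ (B₂ + 1) - φ B₂)))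
    {ε : ℝ} (hε : 0 < ε) :
    mixingTime (fun y z : Fin (K + 1) → Bool =>
        t * ptGraphSwap μ (fun r : Fin m => (((0 : Fin (K + 1)), (κ r).succ) : Fin (K + 1) × Fin (K + 1))) (fun _ : Fin m => Equiv.refl Bool) y z
          + (1 - t) * prodKernel w M y z) (tensorFun μ) ε
      ≤ ⌈1 / ((1 - t) * w 0 * ρ / 4) * Real.log ((Real.exp 1 * (K + 2 * Φm) + 1) / ε)⌉₊ := by
  let Ψa : ℝ → ℝ → ℝ := fun D N => if 1 ≤ D then D + φ N + φ (N + D) else 0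
  let cnt : (Fin (K + 1) → Bool) × (Fin (K + 1) → Bool) → Bool → Bool → ℝ :=
    fun a s t' => ((univ.filter fun i : Fin K => a.1 i.succ = s ∧ a.2 i.succ = t').card : ℝ)
  let Dc : (Bool → Bool → ℝ) → ℝ := fun c => c b (!b) + c (!b) b
  let Nc : (Bool → Bool → ℝ) → ℝ := fun c => c (!b) (!b)
  let hh : ℝ := (1 - t) * w 0
  let c : ℝ := t / K
  let p1 : ℝ → ℝ → ℝ → ℝ := fun G N D => t + hh - c * G
  let p2 : ℝ → ℝ → ℝ → ℝ := fun G N D => t + hh - c * ((G + 1) * (1 - rr) + (N - 1) + D * (1 - rr))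
  let p3 : ℝ → ℝ → ℝ → ℝ := fun G N D => t + hh - c * ((G + 1) * (1 - rr) + (D - 1))
  let det : ℝ → ℝ → ℝ → ℝ := fun G N D => p1 G N D * (p2 G N D * p3 G N D - (c * D * rr) * (c * N))
      - c ^ 2 * N * (G + 1) * rr * (p3 G N D + c * D * rr) - c ^ 2 * D * (G + 1) * rr * (c * N + p2 G N D)
  let detu : ℝ → ℝ → ℝ → ℝ := fun G N D => hh * Ψa D N * (p2 G N D * p3 G N D - (c * D * rr) * (c * N))
      + hh * Ψa D (N - 1) * (c * N * (p3 G N D + c * D)) + hh * Ψa (D - 1) N * (c * D * (c * N * rr + p2 G N D))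
  let detv : ℝ → ℝ → ℝ → ℝ := fun G N D => hh * Ψa D (N - 1) * (p1 G N D * p3 G N D - c ^ 2 * D * (G + 1) * rr)
      + hh * Ψa D N * (c * (G + 1) * rr * (p3 G N D + c * D * rr)) + hh * Ψa (D - 1) N * (c * D * rr * (p1 G N D + c * (G + 1)))
  let detw : ℝ → ℝ → ℝ → ℝ := fun G N D => hh * Ψa (D - 1) N * (p1 G N D * p2 G N D - c ^ 2 * N * (G + 1) * rr)
      + hh * Ψa D (N - 1) * (c * N * (p1 G N D + c * (G + 1) * rr)) + hh * Ψa D N * (c * (G + 1) * rr * (c * N + p2 G N D))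
  let U : ℝ → ℝ → ℝ := fun D N => detu (K - D - N) N D / det (K - D - N) N D
  let V : ℝ → ℝ → ℝ := fun D N => detv (K - D - N - 1) (N + 1) D / det (K - D - N - 1) (N + 1) D
  let Wf : ℝ → ℝ → ℝ := fun D N => detw (K - D - N - 1) N (D + 1) / det (K - D - N - 1) N (D + 1)
  have hmK : (m : ℝ) = c0 * K := uniformList_card κ hunif
  have hK1 : (1 : ℝ) ≤ K := by
    have hK0 : K ≠ 0 := by
      intro h0; have : (m : ℝ) = 0 := by rw [hmK, h0]; simp
      exact absurd (by exact_mod_cast this : m = 0) (by omega)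
    exact_mod_cast Nat.one_le_iff_ne_zero.mpr hK0
  refine boolStar_mixingTime_le_of_lipschitzPotential κ hm ht0.le ht1 hw0 hw00 hw1 hμ hμ1 hM0 hidle hhom hunif hb hrr
    (cnt := cnt) (fun a s t' => rfl) (Dc := Dc) (Nc := Nc) (fun c => rfl) (fun c => rfl) hφ0 hφ (Ψa := Ψa) (fun D N => rfl) (Ψmax := K + 2 * Φm)
    (p1 := p1) (p2 := p2) (p3 := p3) (det := det) (detu := detu) (detv := detv) (detw := detw)
    (fun G N D => rfl) (fun G N D => rfl) (fun G N D => rfl) (fun G N D => rfl) (fun G N D => rfl) (fun G N D => rfl) (fun G N D => rfl)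
    (U := U) (V := V) (W := Wf) (fun D N => rfl) (fun D N => rfl) (fun D N => rfl) (fun a => ?_) hρ0 hρ1
    (fun a => boolStar_oneCopyDrift_contr ht0 ht1 hw00 hμ hμ1 hK1 hb hrr (cnt := cnt) (fun a s t' => rfl) (Dc := Dc) (Nc := Nc)
      (fun c => rfl) (fun c => rfl) hφ0 (Ψa := Ψa) (fun D N => rfl) (p1 := p1) (p2 := p2) (p3 := p3) (det := det) (detu := detu) (detv := detv)
      (fun G N D => rfl) (fun G N D => rfl) (fun G N D => rfl) (fun G N D => rfl) (fun G N D => rfl) (fun G N D => rfl)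
      (U := U) (V := V) (fun D N => rfl) (fun D N => rfl) hπb hπb' h1D a) hε
  -- `Ψa ≤ K + 2Φm` on configurations
  have hc0' : ∀ s t', (0 : ℝ) ≤ cnt a s t' := fun s t' => Nat.cast_nonneg _
  have htot := boolStar_cnt_total (cnt := cnt) (fun a s t' => rfl) b a
  have b1 : φ (Nc (cnt a)) ≤ Φm := by
    have h1 : ((univ.filter fun i : Fin K => a.1 i.succ = !b ∧ a.2 i.succ = !b).card : ℝ) ≤ K := by
      show cnt a (!b) (!b) ≤ K; linarith [hc0' b b, hc0' b (!b), hc0' (!b) b]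
    exact hφm _ (by exact_mod_cast h1)
  have b2 : φ (Nc (cnt a) + Dc (cnt a)) ≤ Φm := by
    have e2 : Nc (cnt a) + Dc (cnt a) = (((univ.filter fun i : Fin K => a.1 i.succ = !b ∧ a.2 i.succ = !b).card
        + ((univ.filter fun i : Fin K => a.1 i.succ = b ∧ a.2 i.succ = !b).card
        + (univ.filter fun i : Fin K => a.1 i.succ = !b ∧ a.2 i.succ = b).card) : ℕ) : ℝ) := by push_cast; rfl
    have h2 : (((univ.filter fun i : Fin K => a.1 i.succ = !b ∧ a.2 i.succ = !b).card : ℝ)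
        + (((univ.filter fun i : Fin K => a.1 i.succ = b ∧ a.2 i.succ = !b).card : ℝ)
        + ((univ.filter fun i : Fin K => a.1 i.succ = !b ∧ a.2 i.succ = b).card : ℝ))) ≤ K := by
      show cnt a (!b) (!b) + (cnt a b (!b) + cnt a (!b) b) ≤ K; linarith [hc0' b b]
    rw [e2]; exact hφm _ (by exact_mod_cast h2)
  show (if 1 ≤ Dc (cnt a) then Dc (cnt a) + φ (Nc (cnt a)) + φ (Nc (cnt a) + Dc (cnt a)) else 0) ≤ (K : ℝ) + 2 * Φm
  have hΦ0 : 0 ≤ Φm := (hφ0 _).trans b1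
  split_ifs
  · have : Dc (cnt a) ≤ (K : ℝ) := by show cnt a b (!b) + cnt a (!b) b ≤ (K : ℝ); linarith [hc0' b b, hc0' (!b) (!b)]
    linarith
  · positivity

end Law

end Summit.Ventures.LatticeQCDFlow.Scaling

end
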